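import Literature.Combinatorics.Sahi2008.FKG
import Summits.CriticalPhenomena.PercolationContinuityZ3.Theorems.PercNearOneGluingNoHeavyLowerTailSahiSlotPatternPositivity

/-!
# The without-replacement / pattern device at every order `n` and every dimension `d` — IV, ORDER 2 IN EVERY DIMENSION:
# the pattern functional is coefficientwise Harris, and `SlotPatternPos d 2` HOLDS (unconditional, standard axioms)

Support file of the one-cut programme (crux `NoHeavyLowerTail`, stmt-CriticalPhenomena-4575; cell `prim-masterthm`, seat P3, gen 18;
`run/shared/lean/prim/prim-masterthm/prim-masterthm-p3/HIERARCHY.md` §26).  Sequel of `…SahiSlotPatternBridge` / `…SahiSlotPatternPositivity`.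

* `diagForm_two` — `D(h) = h₀(δ₀)h₁(δ₀) − h₀(δ₀)h₁(δ₁)` (the two permutations of `Fin 2`, by `decide`);
* `patternForm_two_eq_sum` — on the Boolean cube `[2]^d` the relabellings `τ ∈ S₂^d` ARE the points `p = τ·δ₀` (with `τ·δ₁ = p̄`, the antipode), so
  `patternForm d 2 h = Σ_p h₀(p)(h₁(p) − h₁(p̄))`;
* `sum_setInd_mul_setInd_antipode_le` — the REFLECTED KLEITMAN INEQUALITY `#{p ∈ U : p̄ ∈ V} ≤ #(U ∩ V)` for up-sets `U, V ⊆ [2]^d` (Harris twice under the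
  uniform weight, which is FKG: `2^d·#(U ∩ σV) ≤ #U·#V ≤ 2^d·#(U ∩ V)`; the tree's `ex_mul_ex_le_ex_mul`);
* **`slotPatternPos_two : ∀ d, SlotPatternPos d 2`** — the order-2 row of the `(d,n)` table is a theorem in every dimension (coefficientwise Harris for product weights on
  `d`-dimensional grids, in the slot normal form), and `liebSahiContinuum_two_of_slots` re-derives `LiebSahiContinuum d 2` through the slots.
So the new definitions are anchored at `n = 1` (`slotPatternPos_one`), `n = 2` (this file, all `d`) and `n = 3` (`…SahiSlotPatternThree`: `= sStarD`).  Everything proved;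
axioms standard. [this work]
-/

noncomputable section

namespace Summit.CriticalPhenomena.PercolationContinuityZ3.Theorems

open Finset Function Equiv Equiv.Perm
open Literature.Combinatorics.Sahi2008 Literature.Combinatorics.Sahi2008.CycleForm

namespace SahiSlot

/-! ### Order 2 in EVERY dimension: the pattern functional is coefficientwise Harris, and `SlotPatternPos d 2` HOLDS -/

section Two

variable {d : ℕ}

/-- The two permutations of `Fin 2`. [this work] -/
private theorem univ_perm_fin_two : (univ : Finset (Perm (Fin 2))) = {1, swap 0 1} := by decide

/-- **Order 2, closed form of the diagonal form**: `D(h) = h₀(δ₀)h₁(δ₀) − h₀(δ₀)h₁(δ₁)`. [this work] -/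
theorem diagForm_two (h : Fin 2 → Q d 2 → ℝ) : diagForm d 2 h = h 0 (diag 0) * h 1 (diag 0) - h 0 (diag 0) * h 1 (diag 1) := by
  unfold diagForm
  rw [univ_perm_fin_two, sum_insert (by decide), sum_singleton]
  simp only [Fin.prod_univ_two,
    show (orbits (1 : Perm (Fin 2))).card = 2 by decide, show rep (1 : Perm (Fin 2)) 0 = 0 by decide, show rep (1 : Perm (Fin 2)) 1 = 1 by decide,
    show (orbits (swap 0 1 : Perm (Fin 2))).card = 1 by decide, show rep (swap 0 1 : Perm (Fin 2)) 0 = 0 by decide,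
    show rep (swap 0 1 : Perm (Fin 2)) 1 = 0 by decide]
  norm_num
  ring

/-- A permutation of `Fin 2` sends `1` to the reverse of where it sends `0`. [this work] -/
private theorem perm_fin_two_one (σ : Perm (Fin 2)) : σ 1 = Fin.rev (σ 0) := by revert σ; decide

/-- Evaluation at `0`: `S₂ ≃ Fin 2`. [this work] -/
private def ev0 : Perm (Fin 2) ≃ Fin 2 where
  toFun σ := σ 0
  invFun i := if i = 0 then 1 else swap 0 1
  left_inv σ := by revert σ; decide
  right_inv i := by revert i; decide

/-- The antipode `p ↦ rev ∘ p` of the Boolean cube `[2]^d`. [this work] -/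
def antipode (p : Q d 2) : Q d 2 := fun a => Fin.rev (p a)

/-- The antipode is an involution. [this work] -/
theorem antipode_antipode (p : Q d 2) : antipode (antipode p) = p := by
  funext a; simp [antipode, Fin.rev_rev]

/-- The antipode reverses the order. [this work] -/
theorem antipode_antitone : Antitone (antipode (d := d)) := fun _ _ hpq a => Fin.rev_le_rev.2 (hpq a)

/-- **Order 2: the pattern functional on the Boolean cube** — `patternForm d 2 h = Σ_{p ∈ [2]^d} h₀(p)·(h₁(p) − h₁(p̄))`, `p̄` the antipode
(the relabellings `τ ∈ S₂^d` are the points `p = τ·δ₀`, with `τ·δ₁ = p̄`). [this work] -/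
theorem patternForm_two_eq_sum (h : Fin 2 → Q d 2 → ℝ) :
    patternForm d 2 h = ∑ p : Q d 2, h 0 p * (h 1 p - h 1 (antipode p)) := by
  unfold patternForm
  simp_rw [diagForm_two]
  rw [← (Equiv.piCongrRight fun _ : Fin d => ev0).sum_comp]
  refine Fintype.sum_congr _ _ fun τ => ?_
  have h0 : act τ (diag 0) = (Equiv.piCongrRight fun _ : Fin d => ev0) τ := by funext a; rfl
  have h1 : act τ (diag 1) = antipode ((Equiv.piCongrRight fun _ : Fin d => ev0) τ) := by
    funext a; simp only [act, diag, antipode, Equiv.piCongrRight_apply]; exact perm_fin_two_one (τ a)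
  simp only [comp_apply, h0, h1]
  ring

/-- The uniform weight on the Boolean cube `[2]^d` is an FKG probability weight (the lattice condition holds with equality). [this work] -/
theorem isFKGMeasure_uniform_two : IsFKGMeasure (fun _ : Q d 2 => (1 : ℝ) / (Fintype.card (Q d 2) : ℝ)) where
  nonneg _ := by positivity
  sum_eq_one := by
    rw [sum_const, card_univ, nsmul_eq_mul, mul_one_div, div_self]
    exact_mod_cast Fintype.card_ne_zero
  mul_le_mul _ _ := le_rfl

/-- Expectation under the uniform weight is the normalised sum. [this work] -/
private theorem ex_uniform (f : Q d 2 → ℝ) :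
    ex (fun _ : Q d 2 => (1 : ℝ) / (Fintype.card (Q d 2) : ℝ)) f = (∑ p, f p) / (Fintype.card (Q d 2) : ℝ) := by
  unfold ex; rw [sum_div]; exact sum_congr rfl fun p _ => by ring

/-- **Reflected Kleitman inequality on the Boolean cube**: for up-sets `U, V ⊆ [2]^d`, `#{p ∈ U : p̄ ∈ V} ≤ #(U ∩ V)` — in indicator form
`Σ_p 1_U(p)1_V(p̄) ≤ Σ_p 1_U(p)1_V(p)` (Harris twice under the uniform weight: `N·#(U∩σV) ≤ #U·#V ≤ N·#(U∩V)`, `N = 2^d`). [this work] -/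
theorem sum_setInd_mul_setInd_antipode_le {U V : Finset (Q d 2)} (hU : IsUpperSet (U : Set (Q d 2))) (hV : IsUpperSet (V : Set (Q d 2))) :
    ∑ p, setInd U p * setInd V (antipode p) ≤ ∑ p, setInd U p * setInd V p := by
  set N : ℝ := (Fintype.card (Q d 2) : ℝ) with hN
  have hNpos : 0 < N := by rw [hN]; exact_mod_cast Fintype.card_pos
  have hμ := isFKGMeasure_uniform_two (d := d)
  have hUm : Monotone (setInd U) := monotone_setInd hU
  have hVm : Monotone (setInd V) := monotone_setInd hV
  -- Harris for (1_U, 1_V):  (Σ1_U)(Σ1_V) ≤ N Σ 1_U 1_V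
  have hA := Literature.Combinatorics.Sahi2008.ex_mul_ex_le_ex_mul hμ (fun p => setInd_nonneg U p) (fun p => setInd_nonneg V p) hUm hVm
  simp only [ex_uniform, Pi.mul_apply] at hA
  -- Harris for (1_U, 1 − 1_V ∘ antipode):
  have hg0 : ∀ p, 0 ≤ 1 - setInd V (antipode p) := fun p => by unfold setInd; split_ifs <;> norm_num
  have hgm : Monotone fun p => 1 - setInd V (antipode p) := fun p q hpq => by
    have := hVm (antipode_antitone hpq); linarith
  have hB := Literature.Combinatorics.Sahi2008.ex_mul_ex_le_ex_mul hμ (fun p => setInd_nonneg U p) hg0 hUm hgm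
  simp only [ex_uniform, Pi.mul_apply] at hB
  -- reflect the sum Σ 1_V(p̄) = Σ 1_V(p)
  have hrefl : ∑ p : Q d 2, setInd V (antipode p) = ∑ p, setInd V p :=
    Fintype.sum_equiv (Equiv.ofBijective antipode ⟨fun p q h => by rw [← antipode_antipode p, h, antipode_antipode],
      fun p => ⟨antipode p, antipode_antipode p⟩⟩) _ _ fun _ => rfl
  have hsumB : ∑ p : Q d 2, (1 - setInd V (antipode p)) = N - ∑ p, setInd V p := by
    rw [sum_sub_distrib, hrefl, sum_const, card_univ, nsmul_eq_mul, mul_one]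
  have hsumUB : ∑ p : Q d 2, setInd U p * (1 - setInd V (antipode p)) = ∑ p, setInd U p - ∑ p, setInd U p * setInd V (antipode p) := by
    rw [← sum_sub_distrib]; exact sum_congr rfl fun p _ => by ring
  rw [hsumB, hsumUB] at hB
  -- clear denominators
  rw [div_mul_div_comm, div_le_div_iff₀ (mul_pos hNpos hNpos) hNpos] at hA hB
  have h1 : (∑ p, setInd U p * setInd V (antipode p)) * (N * N) ≤ (∑ p, setInd U p * setInd V p) * (N * N) := by
    linarith [hA, hB]
  exact le_of_mul_le_mul_right h1 (mul_pos hNpos hNpos)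

/-- **`SlotPatternPos d 2` holds in every dimension** (order 2 of the slot-pattern hierarchy = coefficientwise Harris on `d`-dimensional grids). [this work] -/
theorem slotPatternPos_two (d : ℕ) : SlotPatternPos d 2 := by
  intro U hU
  rw [patternForm_two_eq_sum]
  have h := sum_setInd_mul_setInd_antipode_le (hU 0) (hU 1)
  have : ∑ p : Q d 2, setInd (U 0) p * (setInd (U 1) p - setInd (U 1) (antipode p)) =
      ∑ p, setInd (U 0) p * setInd (U 1) p - ∑ p, setInd (U 0) p * setInd (U 1) (antipode p) := by
    rw [← sum_sub_distrib]; exact sum_congr rfl fun p _ => by ring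
  rw [this]
  linarith

/-- **Order ≤ 2 of the continuous case re-derived through the slots**: `LiebSahiContinuum d 2` for every `d` (= the FKG inequality for Lebesgue measure on `[0,1]^d`;
the tree has it as `liebSahiContinuum_of_order_le_two` — this is the slot-normal-form proof). [this work] -/
theorem liebSahiContinuum_two_of_slots (d : ℕ) : LiebSahiContinuum d 2 := liebSahiContinuum_of_slotPatternPos (slotPatternPos_two d)

end Two

end SahiSlot

end Summit.CriticalPhenomena.PercolationContinuityZ3.Theorems
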